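import Literature.MathematicalPhysics.QuantumLattice.FermiRG.BGM2006Sec2Expansion
import Literature.MathematicalPhysics.QuantumLattice.FermiRG.BGM2006Sec2TwoPoint
import HarnessLib

/-!
# Benfatto–Giuliani–Mastropietro 2006, Theorem 2.1: the statement SHAPE (2.77) on an explicit carrier, and
the bridge between the two (2.77) bookkeepings of the wave (tree skeleton `GNTree` ↔ labelled-tree profile)

Topic `Literature/MathematicalPhysics/QuantumLattice/FermiRG`; source BGM06 = G. Benfatto, A. Giuliani,
V. Mastropietro, *Fermi liquid behavior in the 2D Hubbard model at low temperatures*, Ann. Henri Poincaré 7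
(2006) 809–898, arXiv:cond-mat/0507686, §2.8, Theorem 2.1 (2.76)–(2.78); locators `p00NN:Lnn` = chunk/line of
the `lit read` render of the arXiv TeX (equation numbers are the stable locators).  Companion of the typer-wave
files `BGM2006Sec2Expansion.lean` (cell `gate-hubbard-kl`, seat t1, file F1b — DEFINITION FROZEN, not edited)
and `BGM2006Sec2TwoPoint.lean` (seat t2, file F2a: Lemmas 2.4/2.5, the `F = 3, 5` lines (2.98) of the same
bound); both are imported, nothing of theirs is restated.

## Why a separate module, and what it does NOT do (GAP G-t1-1, class W-004)

The SUBJECT of Theorem 2.1 is `J^{(F)}_{h,n}(τ,P,T)` (2.76): the sector sum, weighted by the constraint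
functions `χ(Ω_v)` (2.73), of the `L¹` norm of the renormalised tree-expansion value `W^{(mod)}_{τ,P,Ω,T}` of
(2.61)–(2.72).  That object (the BGM expansion itself) is not in the tree and is not built here; Theorem 2.1
therefore CANNOT be a closed named fact (`def … : Prop` without parameters) — the cell records this as the
gap row G-t1-1 (FACT-LIST F-006 "typed around", §G E-006/E-010).  What this file adds is the agreed
substitute used throughout the wave (FST3 `theorem11_i`, DR2000 `Thm1Shape`, FKT2004 `TheoremIConclusion`,
t2's `Lemma25`): the printed statement as a `Prop`-valued PREDICATE on an explicit carrier — a family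
`𝒯 : ι → LabelledTree` of labelled-tree profiles (index `i` = the labelled tree `(τ, P, T)` together with the
choice of `Ω_ext^{(F)}`) and the VALUES `J : ι → ℕ → ℝ`, `J i F` standing for `J^{(F)}_{h,n}(τ,P,T)` — with
the hypotheses (2.36), (2.71a) and the `c₀ = U₀|h_β|` device at the norm level of `BGM2006Sec3.ScaleData`,
literally the sibling of `BGM2006Sec2TwoPoint.Lemma25` for `F ∈ {0, 1}`.  Nothing is asserted: a consumer
(the K1/K3 skeletons of the KL programme) instantiates the carrier with the BGM objects and ASSUMES
`BGMTheorem21 …` as a hypothesis.  No named fact, no `sorry`, no axiom, no instance, no notation.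

## The two bookkeepings of the right-hand side of (2.77), and the proved bridge

F1b computes the right-hand side `(c|U|)ⁿ γ^{h(e_F − ¾|P_{v₀}|)} Π_{v not e.p.} (1/s_v!) γ^{δ(|P_v|)}` by
structural recursion on the power-counting skeleton `GNTree` (`GNTree.bgmTreeBound`, `GNTree.vertexWeight`,
`γ = 4`); F2a/F2b compute the same product as a `Finset` product over the vertex family of a
`BGM2006Sec3.LabelledTree` profile (`BGM2006Sec2TwoPoint.prod277`).  Here `GNTree.profile t h` is the
labelled-tree profile of a skeleton with root scale `h` (vertices numbered in depth-first preorder,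
`h_v = h + 1 + depth`, `h_{v'} = h_v − 1` since the trivial vertices are vertices, §2.6 item 2) p0012:L81), and
`GNTree.prod277_profile` PROVES `prod277 4 (t.profile h) = t.vertexWeight`, whence
`GNTree.bgmTreeBound_eq_rhs277`: the two right-hand sides coincide, and `bgmBound277_profile_iff`: the bound
(2.77) on the profile carrier is the bound by `GNTree.bgmTreeBound` (for `F ∈ {0,1}`, where t1's
`bgmExternalExp` and t2's `externalExp` agree, `externalExp_eq_bgmExternalExp`).

## Dispositions of the cross-read flags on F1b (HOME/xread/F1b-by-t2.md, N1–N5; F1b itself is frozen)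

* N1 (`GNTree.Admissible` admits inner `|P_v| = 4`): `GNTree.Admissible` is exactly the hypothesis of the
  proved telescoping `GNTree.bgm_powerCounting` (even `|P_v| ≥ 4`).  The printed tree-shape constraint —
  "clusters with `|P_v| = 2` are not allowed, and clusters with `|P_v| = 4` are necessarily endpoints"
  (Remark after (2.78), p0015:L75), i.e. every non-endpoint vertex STRICTLY BELOW `v₀` has even `|P_v| ≥ 6`
  (`ℛ = 1 − ℒ` (2.20)–(2.21) acts there), `v₀` itself having an even number `|P_{v₀}| ∈ {0, 2, 4, ≥ 6}` of
  external legs and never being an endpoint (§2.6 item 2) p0012:L89) — is typed here as `GNTree.IsBGMTree`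
  (with `GNForest.AdmissibleBelow`), with the two proved links: `IsBGMTree ∧ 4 ≤ |P_{v₀}| → Admissible`
  (`GNTree.IsBGMTree.admissible`) and the Remark's consequence `Σ_{v > v₀} δ(|P_v|) ≤ −½·#{v > v₀ not e.p.}`
  (`GNForest.deltaSum_le_of_admissibleBelow`, from F1b's `bgmDelta_le_neg_half`).
* N2 (endpoints of scale `+1` with `≥ 6` legs are outside the skeleton): as printed, "We shall describe the
  proof in the case that all the endpoints are of type `λ`. A posteriori, it will be clear that the possible
  presence of endpoints of scale `+1` with `p ≥ 6` external legs … does not qualitatively change the argument"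
  (p0015:L92–96); `GNTree.endpt` (four legs) is that case; recorded in the docstring of `GNTree.IsBGMTree`.
* N3 (`IsSectorEnvelope` requires `0 ≤ F̃ ≤ 1`): our normalisation of BGM's unspecified "smooth function `= 1`
  on `S_{h,ω}` with a support slightly greater" (p0014:L70) — satisfiable (smooth bump), only ever a hypothesis
  on a candidate `F̃`; harmless, kept.
* N4 (`BGMSectorCompatible`'s `sgn : Fin q → ℤ` unconstrained): the predicate is fed the true charges
  `ε(f) = ±1` by the consumer; kept (t2's `BGM2006AppA.chi` uses `Bool`; a bridge is t2's TODO).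
* N5 (`bgmExternalExp F = 5/2` for every `F ≠ 0`): `bgmExternalExp` is meaningful for `F ∈ {0, 1}` only (the two
  lines of (2.77)); the four printed exponents `e_0 = 2, e_1 = 5/2, e_3 = 3, e_5 = 7/2` live in t2's
  `BGM2006Sec2TwoPoint.externalExp`, which `BGMBound277` uses; agreement on `F ≤ 1` is
  `externalExp_eq_bgmExternalExp`.

## Sources

* [BGM06] G. Benfatto, A. Giuliani, V. Mastropietro, Ann. Henri Poincaré 7 (2006) 809–898,
  arXiv:cond-mat/0507686, §2.6 (p0012:L52–p0013), §2.8 Theorem 2.1 (p0015:L56–L96), (2.83)ff (p0016:L10–L19).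
  [BenfattoGiulianiMastropietro2006]
-/

noncomputable section

open Finset

namespace Literature.MathematicalPhysics.QuantumLattice.FermiRG

/-! ### §2.6 / Remark after (2.78): the printed tree-shape constraint (XREAD N1, N2) -/

mutual
/-- Every non-endpoint vertex of the (sub)tree has an EVEN number `|P_v| ≥ 6` of external fields — the shape
of the part of a tree `τ ∈ 𝒯_{h,n}` strictly below `v₀`: "By construction, clusters with `|P_v| = 2` are not
allowed, and clusters with `|P_v| = 4` are necessarily endpoints" (Remark after (2.78), p0015:L75; `ℛ = 1 − ℒ`
of (2.20)–(2.21) annihilates the `2`- and `4`-leg kernels at every vertex following `v₀`).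
[cite: BenfattoGiulianiMastropietro2006, §2.8 Remark after (2.78)] -/
def GNTree.AdmissibleBelow : GNTree → Prop
  | .endpt => True
  | .vtx p cs => Even p ∧ 6 ≤ p ∧ cs.AdmissibleBelow

/-- `AdmissibleBelow` for every tree of a forest. [cite: BenfattoGiulianiMastropietro2006, §2.8 Remark after (2.78)] -/
def GNForest.AdmissibleBelow : GNForest → Prop
  | .nil => True
  | .cons t f => t.AdmissibleBelow ∧ f.AdmissibleBelow
end

/-- **The printed shape of a tree `τ ∈ 𝒯_{h,n}`** as a constraint on its power-counting skeleton: the vertex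
`v₀` immediately following the root "can not be an endpoint" (§2.6 item 2), p0012:L89), carries an even number
`|P_{v₀}|` of external legs (`0`: free energy (2.75); `2`: the quadratic part; `4`, `≥ 6`), and every
non-endpoint vertex strictly below `v₀` has even `|P_v| ≥ 6` (Remark after (2.78)).  Endpoints are of type
`λ` (four legs): "We shall describe the proof in the case that all the endpoints are of type `λ`. A posteriori,
it will be clear that the possible presence of endpoints of scale `+1` with `p ≥ 6` external legs (produced by
the ultraviolet integration, see Appendix A1) does not qualitatively change the argument" (p0015:L92–96) — the
skeleton `GNTree` of F1b covers exactly that case (XREAD N2).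
[cite: BenfattoGiulianiMastropietro2006, §2.6 item 2), §2.8 Remark after (2.78)] -/
def GNTree.IsBGMTree : GNTree → Prop
  | .endpt => False
  | .vtx p cs => Even p ∧ cs.AdmissibleBelow

mutual
/-- A subtree of the printed shape satisfies F1b's power-counting admissibility (even `|P_v| ≥ 4`).
[cite: BenfattoGiulianiMastropietro2006, §2.8 Remark after (2.78)] -/
theorem GNTree.AdmissibleBelow.admissible : ∀ {t : GNTree}, t.AdmissibleBelow → t.Admissible
  | .endpt, _ => trivial
  | .vtx _ _, h => ⟨h.1, le_trans (by norm_num) h.2.1, GNForest.AdmissibleBelow.admissible h.2.2⟩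

/-- Forest version of `GNTree.AdmissibleBelow.admissible`. [cite: BenfattoGiulianiMastropietro2006, §2.8 Remark after (2.78)] -/
theorem GNForest.AdmissibleBelow.admissible : ∀ {f : GNForest}, f.AdmissibleBelow → f.Admissible
  | .nil, _ => trivial
  | .cons _ _, h => ⟨GNTree.AdmissibleBelow.admissible h.1, GNForest.AdmissibleBelow.admissible h.2⟩
end

/-- A tree of the printed shape with `|P_{v₀}| ≥ 4` is admissible for the power counting of F1b
(`GNTree.bgm_powerCounting`); the cases `|P_{v₀}| ∈ {0, 2}` are the `F = 0` line / the two-leg kernels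
treated separately in §3 ((3.6)–(3.7)). [cite: BenfattoGiulianiMastropietro2006, §2.8 Theorem 2.1 (2.77)] -/
theorem GNTree.IsBGMTree.admissible {t : GNTree} (ht : t.IsBGMTree) (h4 : 4 ≤ t.extLegs) : t.Admissible := by
  cases t with
  | endpt => exact trivial
  | vtx p cs => exact ⟨ht.1, h4, GNForest.AdmissibleBelow.admissible ht.2⟩

mutual
/-- The number of NON-ENDPOINT vertices of a (sub)tree (trivial vertices included, §2.6 item 2)) — the index
set of the product `Π_{v not e.p.}` in (2.77). [cite: BenfattoGiulianiMastropietro2006, §2.6 item 2)] -/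
def GNTree.numVtx : GNTree → ℕ
  | .endpt => 0
  | .vtx _ cs => cs.numVtx + 1

/-- Number of non-endpoint vertices of a forest. [cite: BenfattoGiulianiMastropietro2006, §2.6 item 2)] -/
def GNForest.numVtx : GNForest → ℕ
  | .nil => 0
  | .cons t f => t.numVtx + f.numVtx
end

mutual
/-- **Remark after (2.78)**, quantitative form on the skeleton: below `v₀` every vertex factor has
`δ(|P_v|) ≤ −½`, hence `Σ_{v not e.p.} δ(|P_v|) ≤ −½ · #{v not e.p.}` for a subtree of the printed shape —
"Then the exponent `δ(|P_v|)` appearing in (2.77) is always `≤ −1/2` and, as a consequence, … the sums over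
`P` and `τ` in (2.75) converge exponentially" (p0015:L77–80). [cite: BenfattoGiulianiMastropietro2006, §2.8 Remark after (2.78)] -/
theorem GNTree.deltaSum_le_of_admissibleBelow : ∀ {t : GNTree}, t.AdmissibleBelow →
    t.deltaSum ≤ -(1 / 2) * (t.numVtx : ℝ)
  | .endpt, _ => by simp [GNTree.deltaSum, GNTree.numVtx]
  | .vtx p cs, h => by
      have ih := GNForest.deltaSum_le_of_admissibleBelow h.2.2
      have hδ := bgmDelta_le_neg_half h.1 h.2.1
      simp only [GNTree.deltaSum, GNTree.numVtx, Nat.cast_add, Nat.cast_one]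
      linarith

/-- Forest version of `GNTree.deltaSum_le_of_admissibleBelow`. [cite: BenfattoGiulianiMastropietro2006, §2.8 Remark after (2.78)] -/
theorem GNForest.deltaSum_le_of_admissibleBelow : ∀ {f : GNForest}, f.AdmissibleBelow →
    f.deltaSum ≤ -(1 / 2) * (f.numVtx : ℝ)
  | .nil, _ => by simp [GNForest.deltaSum, GNForest.numVtx]
  | .cons t f, h => by
      have iht := GNTree.deltaSum_le_of_admissibleBelow h.1
      have ihf := GNForest.deltaSum_le_of_admissibleBelow h.2
      simp only [GNForest.deltaSum, GNForest.numVtx, Nat.cast_add]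
      linarith
end

/-- For a tree of the printed shape with root vertex `v₀` of `|P_{v₀}| = p` legs: `Σ_{v not e.p.} δ(|P_v|) ≤
δ(p) − ½ · #{v not e.p., v > v₀}`. [cite: BenfattoGiulianiMastropietro2006, §2.8 Remark after (2.78)] -/
theorem GNTree.deltaSum_vtx_le {p : ℕ} {cs : GNForest} (h : cs.AdmissibleBelow) :
    (GNTree.vtx p cs).deltaSum ≤ bgmDelta p - 1 / 2 * (cs.numVtx : ℝ) := by
  have := GNForest.deltaSum_le_of_admissibleBelow h
  simp only [GNTree.deltaSum]
  linarith

/-! ### The labelled-tree PROFILE of a skeleton (bridge to `BGM2006Sec3.LabelledTree`) -/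

/-- The labels of one non-endpoint vertex read off the skeleton: `|P_v|`, `s_v`, and its depth below the root
vertex `v₀` of the (sub)tree (`h_v = h_{v₀} + depth`). [cite: BenfattoGiulianiMastropietro2006, §2.6 items 1)–2)] -/
structure GNVertexLabel where
  /-- `|P_v|` -/
  legs : ℕ
  /-- `s_v` -/
  branches : ℕ
  /-- `h_v − h_{v₀}` -/
  depth : ℕ

mutual
/-- Depth-first PREORDER lookup of the non-endpoint vertices of a (sub)tree: index `0` is its root vertex, then
the vertices of the subtrees in order (junk `⟨0,0,0⟩` past `numVtx`). [cite: BenfattoGiulianiMastropietro2006, §2.6 items 1)–2)] -/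
def GNTree.vtxData : GNTree → ℕ → GNVertexLabel
  | .endpt, _ => ⟨0, 0, 0⟩
  | .vtx p cs, 0 => ⟨p, cs.len, 0⟩
  | .vtx _ cs, i + 1 => ⟨(cs.vtxData i).legs, (cs.vtxData i).branches, (cs.vtxData i).depth + 1⟩

/-- Preorder lookup through a forest (the trees in order; depth counted from the common parent `+ 1`).
[cite: BenfattoGiulianiMastropietro2006, §2.6 items 1)–2)] -/
def GNForest.vtxData : GNForest → ℕ → GNVertexLabel
  | .nil, _ => ⟨0, 0, 0⟩
  | .cons t f, i => if i < t.numVtx then t.vtxData i else f.vtxData (i - t.numVtx)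
end

/-- **The labelled-tree profile of a skeleton with root scale `h`** (the carrier of F2a/F2b): order
`n = numEndpoints`, root scale `h`, `|P_{v₀}| = extLegs`, vertex family `V = {0, …, numVtx − 1}` (the non-endpoint
vertices in preorder), `|P_v|`, `s_v`, `h_v = h + 1 + depth` ("`v₀` … its scale is `h+1`", p0012:L91) and
`h_{v'} = h_v − 1` (the vertex immediately preceding `v`, trivial vertices being vertices, §2.6 item 2)).
[cite: BenfattoGiulianiMastropietro2006, §2.6 items 1)–2)] -/
def GNTree.profile (t : GNTree) (h : ℤ) : BGM2006Sec3.LabelledTree where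
  n := t.numEndpoints
  h := h
  rootLegs := t.extLegs
  V := Finset.range t.numVtx
  legs i := (t.vtxData i).legs
  branches i := (t.vtxData i).branches
  scale i := h + 1 + ((t.vtxData i).depth : ℤ)
  predScale i := h + ((t.vtxData i).depth : ℤ)

/-- The per-vertex factor `(1/s_v!) γ^{δ(|P_v|)}` of (2.77) at `γ = 4`. [cite: BenfattoGiulianiMastropietro2006, §2.8 (2.77)] -/
def bgmVertexFactor (l : GNVertexLabel) : ℝ := (1 / (l.branches.factorial : ℝ)) * (4 : ℝ) ^ bgmDelta l.legs

/-- Through the root vertex the preorder lookup is the forest lookup shifted by one, with the same `|P_v|`, `s_v`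
(only the depth moves). [cite: BenfattoGiulianiMastropietro2006, §2.8 (2.77)] -/
theorem GNForest.prod_vtxData_shift (p : ℕ) (cs : GNForest) :
    ∏ i ∈ Finset.range cs.numVtx, bgmVertexFactor ((GNTree.vtx p cs).vtxData (i + 1)) =
      ∏ i ∈ Finset.range cs.numVtx, bgmVertexFactor (cs.vtxData i) := by
  refine Finset.prod_congr rfl fun i _ => ?_
  simp only [GNTree.vtxData, bgmVertexFactor]

mutual
/-- The recursive product `GNTree.vertexWeight` of F1b IS the product of the vertex factors over the preorder
enumeration of the non-endpoint vertices. [cite: BenfattoGiulianiMastropietro2006, §2.8 (2.77)] -/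
theorem GNTree.prod_vtxData : ∀ t : GNTree,
    ∏ i ∈ Finset.range t.numVtx, bgmVertexFactor (t.vtxData i) = t.vertexWeight
  | .endpt => by simp [GNTree.numVtx, GNTree.vertexWeight]
  | .vtx p cs => by
      have ih := GNForest.prod_vtxData cs
      simp only [GNTree.numVtx]
      rw [Finset.prod_range_succ', GNForest.prod_vtxData_shift p cs, ih]
      simp only [GNTree.vtxData, GNTree.vertexWeight, bgmVertexFactor]
      ring

/-- Forest version of `GNTree.prod_vtxData`. [cite: BenfattoGiulianiMastropietro2006, §2.8 (2.77)] -/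
theorem GNForest.prod_vtxData : ∀ f : GNForest,
    ∏ i ∈ Finset.range f.numVtx, bgmVertexFactor (f.vtxData i) = f.vertexWeight
  | .nil => by simp [GNForest.numVtx, GNForest.vertexWeight]
  | .cons t f => by
      have iht := GNTree.prod_vtxData t
      have ihf := GNForest.prod_vtxData f
      simp only [GNForest.numVtx, GNForest.vertexWeight]
      rw [Finset.prod_range_add, ← iht, ← ihf]
      congr 1
      · refine Finset.prod_congr rfl fun i hi => ?_
        rw [Finset.mem_range] at hi
        simp only [GNForest.vtxData, if_pos hi]
      · refine Finset.prod_congr rfl fun i _ => ?_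
        simp only [GNForest.vtxData, if_neg (Nat.not_lt.mpr (Nat.le_add_right _ _)), Nat.add_sub_cancel_left]
end

/-- **The two (2.77) bookkeepings agree**: t2's `Finset` product `prod277` (over the vertex family of the
profile, `δ = BGM2006Sec3.scalingDim`) equals t1's recursive `GNTree.vertexWeight` (`δ = bgmDelta`; the two
copies of (2.78) are definitionally equal, cf. `BGM2006AppA.scalingDim_eq_bgmDelta`), at `γ = 4`.
[cite: BenfattoGiulianiMastropietro2006, §2.8 (2.77)] -/
theorem GNTree.prod277_profile (t : GNTree) (h : ℤ) :
    BGM2006Sec2TwoPoint.prod277 4 (t.profile h) = t.vertexWeight := by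
  rw [← GNTree.prod_vtxData t]
  rfl

/-- The whole right-hand side of (2.77): `GNTree.bgmTreeBound c U h e_F t = (c|U|)ⁿ γ^{h(e_F − ¾|P_{v₀}|)} · prod277`
on the profile. [cite: BenfattoGiulianiMastropietro2006, §2.8 Theorem 2.1 (2.77)] -/
theorem GNTree.bgmTreeBound_eq_rhs277 (t : GNTree) (c U : ℝ) (h : ℤ) (eF : ℝ) :
    t.bgmTreeBound c U h eF =
      (c * |U|) ^ (t.profile h).n *
        (4 : ℝ) ^ (((t.profile h).h : ℝ) * (eF - 3 / 4 * ((t.profile h).rootLegs : ℝ))) *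
          BGM2006Sec2TwoPoint.prod277 4 (t.profile h) := by
  rw [GNTree.prod277_profile]
  rfl

/-- In the profile every vertex sits one scale below its predecessor (`h_v − h_{v'} = 1`), so the
`c`-vertex-style product `prodVc` of (3.69) coincides with `prod277` on a full skeleton profile (the
observation of the "Note on the vertex products" in `BGM2006Sec2TwoPoint`). [cite: BenfattoGiulianiMastropietro2006, §3.2 (3.69)] -/
theorem GNTree.prodVc_profile (γ : ℝ) (t : GNTree) (h : ℤ) :
    BGM2006Sec3.prodVc γ (t.profile h) = BGM2006Sec2TwoPoint.prod277 γ (t.profile h) := by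
  unfold BGM2006Sec3.prodVc BGM2006Sec2TwoPoint.prod277
  refine Finset.prod_congr rfl fun i _ => ?_
  simp only [GNTree.profile, add_sub_add_right_eq_sub, add_sub_cancel_left, Int.cast_one, mul_one]

/-! ### Theorem 2.1 (2.77) as a statement shape on the explicit carrier (FACT-LIST F-006, GAP G-t1-1) -/

/-- The printed exponents agree on the two lines of Theorem 2.1: t2's `externalExp` (`e_0 = 2, e_1 = 5/2,
e_3 = 3, e_5 = 7/2`) and t1's `bgmExternalExp` (`e_0 = 2`, else `5/2`) coincide for `F ≤ 1` (XREAD N5: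
`bgmExternalExp` is meaningful for `F ∈ {0,1}` only). [cite: BenfattoGiulianiMastropietro2006, §2.8 (2.77)] -/
theorem externalExp_eq_bgmExternalExp {F : ℕ} (hF : F ≤ 1) :
    BGM2006Sec2TwoPoint.externalExp F = bgmExternalExp F := by
  interval_cases F <;> simp [BGM2006Sec2TwoPoint.externalExp, bgmExternalExp]

/-- **One line of (2.77)/(2.98) for one labelled tree**: the value `JF` (standing for `J^{(F)}_{h,n}(τ,P,T)`,
(2.76)) is at most `(c|U|)ⁿ γ^{h(e_F − ¾|P_{v₀}|)} Π_{v not e.p.} (1/s_v!) γ^{δ(|P_v|)}` with `e_F =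
BGM2006Sec2TwoPoint.externalExp F` (`F = 0, 1`: Theorem 2.1 (2.77) p0015:L64–69; `F = 3, 5`: Lemma 2.5 (2.98)),
`δ` of (2.78), the product over ALL non-endpoint vertices (trivial ones included).  A predicate on the profile
`T` and the number `JF`; nothing asserted. [cite: BenfattoGiulianiMastropietro2006, §2.8 Theorem 2.1 (2.77)] -/
def BGMBound277 (γ U c : ℝ) (T : BGM2006Sec3.LabelledTree) (F : ℕ) (JF : ℝ) : Prop :=
  JF ≤ (c * |U|) ^ T.n * γ ^ ((T.h : ℝ) * (BGM2006Sec2TwoPoint.externalExp F - 3 / 4 * (T.rootLegs : ℝ))) *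
    BGM2006Sec2TwoPoint.prod277 γ T

/-- On a skeleton profile at `γ = 4` the bound (2.77) with `F ∈ {0,1}` is the bound by F1b's
`GNTree.bgmTreeBound c U h (bgmExternalExp F)` — the shape wanted in GAP-LEDGER row G-t1-1.
[cite: BenfattoGiulianiMastropietro2006, §2.8 Theorem 2.1 (2.77)] -/
theorem bgmBound277_profile_iff (t : GNTree) (h : ℤ) (U c : ℝ) {F : ℕ} (hF : F ≤ 1) (JF : ℝ) :
    BGMBound277 4 U c (t.profile h) F JF ↔ JF ≤ t.bgmTreeBound c U h (bgmExternalExp F) := by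
  rw [BGMBound277, GNTree.bgmTreeBound_eq_rhs277, externalExp_eq_bgmExternalExp hF]

/-- **Theorem 2.1 of BGM06 as a statement SHAPE** (p0015:L56–73; FACT-LIST F-006, row BGM06.T2.1, GAP G-t1-1;
DECOMP U6, C5b). *"Theorem 2.1. Given `h_β ≤ h ≤ 0`, `τ ∈ 𝒯_{h,n}`, `P ∈ 𝒫_τ`, `T ∈ 𝐓`, if `E_j(k)` satisfies
(2.36) for any `j ≥ h`, `λ̃_{h_{v*}−1,Ω_{v*}}` satisfies (2.71a) for any endpoint `v* ∈ τ` and `U₀|h_β| = c₀` is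
small enough, then `J^{(0)}_{h,n}(τ,P,T) ≤ (c|U|)ⁿ γ^{h(2 − ¾|P_{v₀}|)} Π_{v not e.p.} (1/s_v!) γ^{δ(|P_v|)}`,
`J^{(1)}_{h,n}(τ,P,T) ≤ (c|U|)ⁿ γ^{h(5/2 − ¾|P_{v₀}|)} Π_{v not e.p.} (1/s_v!) γ^{δ(|P_v|)}` (2.77), where
`δ(p) = 1 − p/4 + 𝟙(p ≥ 10)` (2.78)."*  Here `J^{(F)}` is (2.76), with `Ω_ext^{(F)} ⊂ Ω_{v₀}` "an arbitrary subset
of the sector indices in `Ω_{v₀}` of cardinality `F`" when `|P_{v₀}| > 0` and `0 < F ≤ |P_{v₀}|` (p0015:L42–45) —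
so the `F = 1` line presupposes `|P_{v₀}| ≥ 1`, typed as the guard `1 ≤ rootLegs` (for `|P_{v₀}| = 0` the sum
"coincides with `Σ_Ω`", i.e. only the `F = 0` line is meant).  Typed EXACTLY like its printed generalisation
`BGM2006Sec2TwoPoint.Lemma25` (the `F = 3, 5` lines (2.98)): on the scale-indexed data `D` (carrying `γ`, `U`,
`U₀`, `h_β`), with (2.36) = `Hyp236 D C k` at the indices `h < k ≤ 0` (the reading of "for any `j ≥ h`" adopted
by the wave and approved by the referee for Theorem 3.1: the dispersions `E_0, …, E_h` entering a tree of root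
scale `h` are controlled by (2.36) at `j = h+1, …, 0`; see the module doc of `BGM2006Sec3Flow`, "Reading of the
hypothesis"), (2.71a) = `Bound365 D Cl j` at `h ≤ j ≤ 0` (endpoints have `h_{v*} − 1 ≥ h + 1`), the `c₀` device
`SmallC0 D c₀` (KEPT — dropping it would silently strengthen the statement to the KL regime), the constants
`c, C, Cl, c₀` as PARAMETERS (print: ∃ `c`, and the implication holds once `c₀` is small enough, depending on the
`O(1)` constants), a family `𝒯` of labelled-tree profiles (index `i` = `(τ, P, T, Ω_ext^{(F)})`) and the values
`J i F`.  BGM PROVE this for the data of the 2D Hubbard model at `0 < μ_BGM < (2−√2)/2` (tree: `−4 < μ < −2−√2`);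
here it is a predicate to be ASSUMED for that instance — the subject `J^{(F)}` (2.76) is not constructed (GAP
G-t1-1).  The tree's one-scale form of the bound in the sectorised `L¹–L^∞` norm is
`SectorisedEffectiveActionBound.hubbardSectorKernelNorm_effAction_le` (cited, not restated).
[cite: BenfattoGiulianiMastropietro2006, §2.8 Theorem 2.1 (2.76)–(2.78) p0015:L56] -/
def BGMTheorem21 {ι : Type*} (D : BGM2006Sec3.ScaleData) (c : ℝ) (C : ℕ → ℝ) (Cl c₀ : ℝ)
    (𝒯 : ι → BGM2006Sec3.LabelledTree) (J : ι → ℕ → ℝ) : Prop :=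
  BGM2006Sec3.SmallC0 D c₀ →
    ∀ i : ι, D.hβ ≤ (𝒯 i).h → (𝒯 i).h ≤ 0 →
      (∀ k : ℤ, (𝒯 i).h < k → k ≤ 0 → BGM2006Sec3.Hyp236 D C k) →
        (∀ j : ℤ, (𝒯 i).h ≤ j → j ≤ 0 → BGM2006Sec3.Bound365 D Cl j) →
          BGMBound277 D.γ D.U c (𝒯 i) 0 (J i 0) ∧ (1 ≤ (𝒯 i).rootLegs → BGMBound277 D.γ D.U c (𝒯 i) 1 (J i 1))

/-- The conclusion of t2's `Lemma25` is the pair of (2.98) lines `F = 3, 5` of the same shape `BGMBound277`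
(consistency of the two files' typings; `Lemma25` carries no `F ≤ |P_{v₀}|` guard).
[cite: BenfattoGiulianiMastropietro2006, §2.8 Lemma 2.5 (2.98)] -/
theorem lemma25_iff_bound277 {ι : Type*} (D : BGM2006Sec3.ScaleData) (c : ℝ) (C : ℕ → ℝ) (Cl c₀ : ℝ)
    (𝒯 : ι → BGM2006Sec3.LabelledTree) (J : ι → ℕ → ℝ) :
    BGM2006Sec2TwoPoint.Lemma25 D c C Cl c₀ 𝒯 J ↔
      (BGM2006Sec3.SmallC0 D c₀ →
        ∀ i : ι, D.hβ ≤ (𝒯 i).h → (𝒯 i).h ≤ 0 →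
          (∀ k : ℤ, (𝒯 i).h < k → k ≤ 0 → BGM2006Sec3.Hyp236 D C k) →
            (∀ j : ℤ, (𝒯 i).h ≤ j → j ≤ 0 → BGM2006Sec3.Bound365 D Cl j) →
              BGMBound277 D.γ D.U c (𝒯 i) 3 (J i 3) ∧ BGMBound277 D.γ D.U c (𝒯 i) 5 (J i 5)) := by
  have e3 : BGM2006Sec2TwoPoint.externalExp 3 = 3 := by norm_num [BGM2006Sec2TwoPoint.externalExp]
  have e5 : BGM2006Sec2TwoPoint.externalExp 5 = 7 / 2 := by norm_num [BGM2006Sec2TwoPoint.externalExp]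
  simp only [BGM2006Sec2TwoPoint.Lemma25, BGMBound277, e3, e5]

/-- **The `F = 0` line from the `F = 1` line** (p0016:L14–19) at the level of the right-hand sides: one more
sector sum over `ω₁ ∈ O_h`, `|O_h| = 2γ^{−h/2}`, turns `γ^{h·e_1}` into `γ^{h·e_0}` — on the skeleton carrier this
is F1b's `bgmExternalExp_zero_eq`; here the corresponding identity of the two `BGMBound277` right-hand sides at
`γ = 4`: `rhs(F=0) = 4^{−h/2} · rhs(F=1)`. [cite: BenfattoGiulianiMastropietro2006, §2.8 (2.77), case F = 0] -/
theorem rhs277_zero_eq (t : GNTree) (c U : ℝ) (h : ℤ) :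
    t.bgmTreeBound c U h (bgmExternalExp 0) = (4 : ℝ) ^ (-(h : ℝ) / 2) * t.bgmTreeBound c U h (bgmExternalExp 1) := by
  have e0 : bgmExternalExp 0 = 2 := by simp [bgmExternalExp]
  have e1 : bgmExternalExp 1 = 5 / 2 := by simp [bgmExternalExp]
  rw [e0, e1]
  simp only [GNTree.bgmTreeBound]
  rw [show (h : ℝ) * (2 - 3 / 4 * (t.extLegs : ℝ)) = -(h : ℝ) / 2 + (h : ℝ) * (5 / 2 - 3 / 4 * (t.extLegs : ℝ)) by ring,
    Real.rpow_add (by norm_num : (0 : ℝ) < 4)]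
  ring

/-! ### Non-vacuity and sanity checks (not load-bearing) -/

/-- A free-energy tree of the printed shape: `v₀` with `|P_{v₀}| = 0` followed by one vertex with `|P_v| = 6`
carrying two endpoints of type `λ` (order `n = 2`). [cite: BenfattoGiulianiMastropietro2006, §2.6 Fig. 1] -/
def GNTree.exampleFreeEnergy : GNTree := .vtx 0 (.cons (.vtx 6 (.cons .endpt (.cons .endpt .nil))) .nil)

/-- The example has the printed shape (`IsBGMTree` is inhabited by a tree with an inner vertex).
[cite: BenfattoGiulianiMastropietro2006, §2.6 Fig. 1] -/
theorem GNTree.exampleFreeEnergy_isBGMTree : GNTree.exampleFreeEnergy.IsBGMTree := by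
  simp only [GNTree.exampleFreeEnergy, GNTree.IsBGMTree, GNTree.AdmissibleBelow, GNForest.AdmissibleBelow,
    and_true, le_refl]
  decide

/-- The example has two endpoints and two non-endpoint vertices; its profile lists the labels
`(|P_v|, s_v, h_v, h_{v'}) = (0, 1, h+1, h), (6, 2, h+2, h+1)` in preorder. [cite: BenfattoGiulianiMastropietro2006, §2.6 Fig. 1] -/
theorem GNTree.exampleFreeEnergy_profile (h : ℤ) :
    GNTree.exampleFreeEnergy.numEndpoints = 2 ∧ GNTree.exampleFreeEnergy.numVtx = 2 ∧
      (GNTree.exampleFreeEnergy.profile h).legs 0 = 0 ∧ (GNTree.exampleFreeEnergy.profile h).branches 0 = 1 ∧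
      (GNTree.exampleFreeEnergy.profile h).legs 1 = 6 ∧ (GNTree.exampleFreeEnergy.profile h).branches 1 = 2 ∧
      (GNTree.exampleFreeEnergy.profile h).scale 1 = h + 2 ∧ (GNTree.exampleFreeEnergy.profile h).predScale 0 = h := by
  have d1 : (GNTree.exampleFreeEnergy.vtxData 1).depth = 1 := by rfl
  have d0 : (GNTree.exampleFreeEnergy.vtxData 0).depth = 0 := by rfl
  refine ⟨by rfl, by rfl, by rfl, by rfl, by rfl, by rfl, ?_, ?_⟩
  · simp only [GNTree.profile, d1]
    push_cast
    ring
  · simp only [GNTree.profile, d0]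
    push_cast
    ring

/-- The trivial quartic tree of F1b has profile vertex family `{0}` and vertex product `1` (`δ(4) = 0`, `s = 1`).
[cite: BenfattoGiulianiMastropietro2006, §2.8 (2.96)] -/
theorem GNTree.prod277_trivialQuartic (h : ℤ) :
    BGM2006Sec2TwoPoint.prod277 4 (GNTree.trivialQuartic.profile h) = 1 := by
  rw [GNTree.prod277_profile]
  simp [GNTree.trivialQuartic, GNTree.vertexWeight, GNForest.vertexWeight, GNForest.len, bgmDelta]

end Literature.MathematicalPhysics.QuantumLattice.FermiRG
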